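import Summits.QuantumFields.BalabanUV.Beta.GAN24.TransportedWordTools
import Summits.QuantumFields.BalabanUV.Beta.GAN24.NoFFWordCurrentKill

/-!
# `BalabanUV.Beta.GAN24.TransportedWordReduction` — binder row G-an2-4 ∕ (CONV-C), TRANSFER-III, the (III′) (C)-campaign's supplier `hB0`, (24) AT THE COMB DATA (leaf-01 g85
# `README-g85` «LOCATED» (24)_comb): **A TWO-FACE WORD OF THE DRESSED STEP KERNEL `X̃♮_j` WHOSE TWO HALF-VERTICES SIT OVER TRANSPORTED TABLES `𝒯S′ = Ψ̂ᵀ∘slotPsiS S′∘Ψ̂`, `𝒯T`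
# — `S′` WITHOUT FIELD–FIELD BLOCK ON THE CELL BOND, `T` ON THE RESUMMED LATTICE BOND — VANISHES AS SOON AS THE MULTIPLIER ROWS OF `X̃♮_j` KILL THE EXIT-FACE CURRENT OF THE
# UNTRANSPORTED `T`-VERTEX** (every level `j`, both bond orders): the transports are pushed out of both vertices (g85 F8 §1), the outer legs drop against the exit-face weights
# (`TransportedWordTools` §1), the middle kernel becomes `Ψ̂ X̃♮_j Ψ̂ᵀ` whose multiplier rows pair with a periodic current exactly as those of `X̃♮_j` (Tools §4), and the face-weighted
# bond-resummed current of the `slotPsiS T`-vertex IS that of the `T`-vertex (§1 here, F8 §4) — after which leaf-04 g68's generic word lemmas `NoFFWordCurrentKill` close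
# (G-an2-4 CRUX TEAM (2), leaf prover `b2b-balaban-gan24-formalise-leaf-01`, gen 86; journal [LEAF01-G86-INTENT-1])

NOT IN PRINT; OUR BOOKKEEPING ([folklore] Fubini ∕ tame-kernel bookkeeping BY NAME over `TransportedWordTools`, leaf-01 g85 `CombSlotResumTransport` (§1 `vertexOfK_unitS_transport_eq_conj`,
§4 `tsum_vertexOfK_dressedStep_slotPsiS`, `tsum_prod_swap`), leaf-04 g68 `NoFFWordCurrentKill` (`tsum_noFF_left_right_word_eq_zero_of_current ∕ tsum_left_right_noFF_swap_word_eq_zero_of_current`),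
leaf-04 `ExchangeSlotResum` (`summable_pair_slot`, `face_weight_periodic`), an2's `vertexFamily_vertexOfK`, d1-leaf-03's `SymCorrectorSockets.locStencil_slotPsiS`, leaf-01 g85
`CombTransportedBorder.slotPsiS_unitS`; 0 `def`, 0 cited fact, 0 `def … : Prop`, 0 sorry).
HONEST FRAMING (cell contract, verbatim): «discharging `BetaPertH` makes Bałaban's UV stability UNCONDITIONAL — a real constructive-QFT result; it is NOT the continuum limit and NOT
the Clay problem.»  HONEST DEPENDENCY (verbatim): «continuum YM on T⁴ ⇐ BetaPertH ∧ nine spine estimates (0/9 proved); BetaPertH ⇐ (D1) ∧ (D4) ∧ CAP+tail; G-an2-4 gates asym, D1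
and NE2/3/4.»

## What is proved (generic `d`, `[NeZero Lc]`, `1 ≤ Lc`, in-block kernel root `toSite rb`, `X̃♮_j = unitK s_f s_m (coDressKBmAt (toSite rb) Lc (KInvStep Lc j))`, every `j`, all units)
* §1 **`tsum_prod_weight_vertexOfK_dressedStep_slotPsiS`**: for `|ρ| ≤ 1`, any transport root `r′`, any local `T`, every first leg `(z,f)` and second-leg type `g`,
  `Σ'_{(u′,w)} ρ(w)·vertexOfK X̃♮_j Lc (unitS (slotPsiS r′ Lc T)) ν u′ z w f g = Σ'_{(u′,w)} ρ(w)·vertexOfK X̃♮_j Lc (unitS T) ν u′ z w f g` — the leg-weighted bond-resummed CURRENT does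
  not see the slot transport (Fubini over `summable_pair_slot` ⨾ F8 §4).
* §2 `exists_vertex_data` (one rate), and THE REDUCTION (transport root `r ∈ box`, `𝒯S κ u := Ψ̂ᵀ∘slotPsiS r Lc S κ u∘Ψ̂`, `Ψ̂ = psiKS r Lc`; `S′` local with zero ff block; `T` local):
  **`tsum_transported_direct_word_eq_zero_of_current`** — `Σ'_{u′} Σ'_{(y,w)} 𝟙f(y_α)𝟙f(w_β)·((vertexOfK X̃♮_j Lc (unitS (𝒯S′)) μ c ∘ X̃♮_j) ∘ vertexOfK X̃♮_j Lc (unitS (𝒯T)) ν u′) y w (inl α)(inl β) = 0`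
  whenever `T` has no `(inr ·, inl β)` rows and the multiplier rows of `X̃♮_j` kill a bounded `Lc`-periodic `t` with `Σ'_{(u′,w)} 𝟙f(w_β)·vertexOfK X̃♮_j Lc (unitS T) ν u′ z w (inl b)(inl β) = t b z`
  (the (E) chain's currency: (d1) `DressedKernelOnFaceCurrent` at `j = 0`, `DressedKernelOnCurrentStep.tsum_dressedStep_inr_mul_current` ⟸ (D)∧(Z) at `j ≥ 1`);
  **`tsum_transported_swap_word_eq_zero_of_current`** — the swap word `((vertexOfK … (𝒯T) ν u′ ∘ X̃♮_j) ∘ vertexOfK … (𝒯S′) μ c)`, for leg-antisymmetric `T` without `(inr ·, inl α)` rows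
  and the current read at the leg `inl α`.
WHAT THIS IS NOT: no instance is taken here (level `0` unconditional ∕ the comb data ∕ levels `≥ 1` modulo (D)∧(Z) are `CombVHEWordsZero`); NO value; NOT `hB0`; NEVER «G-an2-4 closed»
as (CONV-C); NOT D1, NOT `BetaPertH`, NOT continuum, NOT Clay.  2026-08-27; no existing file touched.
-/

noncomputable section

open Finset
open scoped BigOperators
open Literature.MathematicalPhysics.QuantumFieldTheory
open Literature.MathematicalPhysics.QuantumFieldTheory.Balaban1983to89
open Literature.MathematicalPhysics.QuantumFieldTheory.Balaban1983to89.Beta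
open ExpKernelCalculus (Site MKer comp Decays BiLoc VertexFamily)
open AffineAveraging (box toSite)
open OneStepResolventKernel (Fib LocStencil decays_mono biLoc_mono)
open OneStepKernelFamily (KInvStep vertexOfK vertexFamily_vertexOfK decays_KInvStep)
open Summit.QuantumFields.BalabanUV.Beta.TameKernelCalculus (trK Spr)
open Summit.QuantumFields.BalabanUV.Beta.BorderedHessian (sgnK)
open Summit.QuantumFields.BalabanUV.Beta.AxialDressingRooted (coDressKBmAt decays_coDressKBmAt)
open Summit.QuantumFields.BalabanUV.Beta.HessKerDressedUnits (unitK unitS decays_unitK locStencil_unitS)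
open Summit.QuantumFields.BalabanUV.Beta.SymCorrectorKernel (psiKS)
open Summit.QuantumFields.BalabanUV.Beta.SymCorrectorFace (slotPsiS)
open Summit.QuantumFields.BalabanUV.Beta.SymCorrectorSockets (locStencil_slotPsiS)
open Summit.QuantumFields.BalabanUV.Beta.GAN24.CombTransportedBorder (slotPsiS_unitS)
open Summit.QuantumFields.BalabanUV.Beta.GAN24.CombSlotResumTransport (vertexOfK_unitS_transport_eq_conj tsum_vertexOfK_dressedStep_slotPsiS tsum_prod_swap)
open Summit.QuantumFields.BalabanUV.Beta.GAN24.ExchangeSlotResum (summable_pair_slot face_weight_periodic)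
open Summit.QuantumFields.BalabanUV.Beta.GAN24.NoFFWordCurrentKill (tsum_noFF_left_right_word_eq_zero_of_current tsum_left_right_noFF_swap_word_eq_zero_of_current)
open Summit.QuantumFields.BalabanUV.Beta.GAN24.TransportedWordTools (exists_decays_sandwich tsum_twoFace_conj_word_eq trK_vertexOfK_unitS_slotPsiS vertexOfK_unitS_slotPsiS_entry_eq_zero
  trK_sandwich_dressedStep tsum_sum_sandwich_inr_inl_mul_eq_zero)

namespace Summit.QuantumFields.BalabanUV.Beta.GAN24.TransportedWordReduction

variable {d : ℕ}

/-! ## §1 The leg-weighted bond-resummed current does not see the slot transport -/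

section Current

variable {Lc : ℕ} [NeZero Lc] {rb : Fin (d + 1) → ℕ}

/-- NOT IN PRINT; OUR BOOKKEEPING ([folklore]).  **THE LEG-WEIGHTED BOND-RESUMMED CURRENT OF THE DRESSED VERTEX OVER `unitS (slotPsiS r′ Lc T)` IS THAT OVER `unitS T`** (in-block kernel root
`toSite rb`, `1 ≤ Lc`, every `j`, all units, any transport root `r′`, any local `T`, any leg weight `|ρ| ≤ 1`, every first leg `(z, f)` and second-leg type `g`):
`Σ'_{(u′,w)} ρ(w)·vertexOfK X̃♮_j Lc (unitS (slotPsiS r′ Lc T)) ν u′ z w f g = Σ'_{(u′,w)} ρ(w)·vertexOfK X̃♮_j Lc (unitS T) ν u′ z w f g` — both pair families are summable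
(`ExchangeSlotResum.summable_pair_slot` on the two vertex families), so the bond sum may be done first (Fubini through the swapped product), where leaf-01 g85 F8 §4
`tsum_vertexOfK_dressedStep_slotPsiS` removes the slot transport (`slotPsiS_unitS`: the units commute with it). -/
theorem tsum_prod_weight_vertexOfK_dressedStep_slotPsiS (hLc : 1 ≤ Lc) (hrb : rb ∈ box (d + 1) Lc) (sf sm : ℝ) (j : ℕ) (ν : Fin (d + 1)) (r' : Fin (d + 1) → ℕ)
    {T : Fin (d + 1) → Site (d + 1) → MKer (d + 1) (Fib d)} {CT δT : ℝ} (hT : LocStencil T CT δT) (hδT : 0 < δT)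
    {ρ : Site (d + 1) → ℝ} (hρ : ∀ w, |ρ w| ≤ 1) (z : Site (d + 1)) (f g : Fib d) :
    ∑' uw : Site (d + 1) × Site (d + 1), ρ uw.2 * vertexOfK (unitK sf sm (coDressKBmAt (toSite rb) Lc (KInvStep (d := d) Lc j))) Lc (unitS sf sm (slotPsiS r' Lc T)) ν uw.1 z uw.2 f g
      = ∑' uw : Site (d + 1) × Site (d + 1), ρ uw.2 * vertexOfK (unitK sf sm (coDressKBmAt (toSite rb) Lc (KInvStep (d := d) Lc j))) Lc (unitS sf sm T) ν uw.1 z uw.2 f g := by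
  classical
  have hLc0 : 0 < Lc := hLc
  set X := unitK sf sm (coDressKBmAt (toSite rb) Lc (KInvStep (d := d) Lc j)) with hX
  -- decay data at a common rate
  obtain ⟨δK, CK, hδK, hCK, hXd⟩ := decays_coDressKBmAt hLc hrb (decays_KInvStep (d := d) (Lc := Lc) j)
  have hXu : Decays X (max |sf| |sm| * CK * max |sf| |sm|) δK := decays_unitK (sf := sf) (sm := sm) hXd
  have hCX : 0 ≤ max |sf| |sm| * CK * max |sf| |sm| := by positivity
  have hCT : 0 ≤ CT := (hT 0 0).nonneg (Sum.inl 0)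
  set m : ℝ := min δK δT with hm
  have hm0 : 0 < m := lt_min hδK hδT
  have hX1 : Decays X (max |sf| |sm| * CK * max |sf| |sm|) m := decays_mono hXu hCX le_rfl (min_le_left _ _)
  have hT1 : LocStencil T CT m := fun κ u => biLoc_mono (hT κ u) hCT (min_le_right _ _)
  have hTu := locStencil_unitS (sf := sf) (sm := sm) hT1
  have hTs := locStencil_slotPsiS (d := d) hLc0 r' hTu hm0.le
  have hV := vertexFamily_vertexOfK (N := Lc) hX1 hCX hTu hm0 le_rfl
  have hVs := vertexFamily_vertexOfK (N := Lc) hX1 hCX hTs hm0 le_rfl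
  rw [← slotPsiS_unitS r' Lc sf sm T]
  -- summability of both pair families, in both leg orders
  have hs1 := summable_pair_slot (N := Lc) (fun u' => vertexOfK X Lc (slotPsiS r' Lc (unitS sf sm T)) ν u') (half_pos hm0) (fun u' => hVs ν u') hρ z f g
  have hs2 := summable_pair_slot (N := Lc) (fun u' => vertexOfK X Lc (unitS sf sm T) ν u') (half_pos hm0) (fun u' => hV ν u') hρ z f g
  have hs1' : Summable fun wu : Site (d + 1) × Site (d + 1) => ρ wu.1 * vertexOfK X Lc (slotPsiS r' Lc (unitS sf sm T)) ν wu.2 z wu.1 f g :=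
    (hs1.comp_injective (Equiv.prodComm (Site (d + 1)) (Site (d + 1))).injective).congr fun wu => rfl
  have hs2' : Summable fun wu : Site (d + 1) × Site (d + 1) => ρ wu.1 * vertexOfK X Lc (unitS sf sm T) ν wu.2 z wu.1 f g :=
    (hs2.comp_injective (Equiv.prodComm (Site (d + 1)) (Site (d + 1))).injective).congr fun wu => rfl
  rw [tsum_prod_swap (fun u w => ρ w * vertexOfK X Lc (slotPsiS r' Lc (unitS sf sm T)) ν u z w f g),
    tsum_prod_swap (fun u w => ρ w * vertexOfK X Lc (unitS sf sm T) ν u z w f g), hs1'.tsum_prod, hs2'.tsum_prod]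
  refine tsum_congr fun w => ?_
  dsimp only
  rw [tsum_mul_left, tsum_mul_left, hX, tsum_vertexOfK_dressedStep_slotPsiS hLc hrb sf sm j ν r' hTu hm0 z w f g]

end Current

/-! ## §2 The reduction: both two-face words over transported tables, every level -/

section Reduction

variable {Lc : ℕ} [NeZero Lc] {rb r : Fin (d + 1) → ℕ} {S' T : Fin (d + 1) → Site (d + 1) → MKer (d + 1) (Fib d)} {Cs δs CT δT : ℝ} {μ ν α β : Fin (d + 1)}

/-- [folklore] **COMMON-RATE VERTEX DATA** for the reduction: the dressed step kernel decays, and the two vertices over `unitS (slotPsiS r Lc S′)`, `unitS (slotPsiS r Lc T)` are vertex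
families at one rate. -/
theorem exists_vertex_data (hLc : 1 ≤ Lc) (hrb : rb ∈ box (d + 1) Lc) (sf sm : ℝ) (j : ℕ) (hS : LocStencil S' Cs δs) (hδs : 0 < δs) (hT : LocStencil T CT δT) (hδT : 0 < δT) :
    ∃ δ CX CP CV : ℝ, 0 < δ ∧ 0 ≤ CX ∧ Decays (unitK sf sm (coDressKBmAt (toSite rb) Lc (KInvStep (d := d) Lc j))) CX δ ∧
      VertexFamily (vertexOfK (unitK sf sm (coDressKBmAt (toSite rb) Lc (KInvStep (d := d) Lc j))) Lc (unitS sf sm (slotPsiS r Lc S'))) Lc CP δ ∧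
      VertexFamily (vertexOfK (unitK sf sm (coDressKBmAt (toSite rb) Lc (KInvStep (d := d) Lc j))) Lc (unitS sf sm (slotPsiS r Lc T))) Lc CV δ := by
  have hLc0 : 0 < Lc := hLc
  obtain ⟨δK, CK, hδK, hCK, hXd⟩ := decays_coDressKBmAt hLc hrb (decays_KInvStep (d := d) (Lc := Lc) j)
  have hXu := decays_unitK (sf := sf) (sm := sm) hXd
  have hCX : 0 ≤ max |sf| |sm| * CK * max |sf| |sm| := by positivity
  have hCs : 0 ≤ Cs := (hS 0 0).nonneg (Sum.inl 0)
  have hCT : 0 ≤ CT := (hT 0 0).nonneg (Sum.inl 0)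
  set m : ℝ := min δK (min δs δT) with hm
  have hm0 : 0 < m := lt_min hδK (lt_min hδs hδT)
  have hX1 : Decays (unitK sf sm (coDressKBmAt (toSite rb) Lc (KInvStep (d := d) Lc j))) (max |sf| |sm| * CK * max |sf| |sm|) m :=
    decays_mono hXu hCX le_rfl (min_le_left _ _)
  have hS1 : LocStencil S' Cs m := fun κ u => biLoc_mono (hS κ u) hCs ((min_le_right _ _).trans (min_le_left _ _))
  have hT1 : LocStencil T CT m := fun κ u => biLoc_mono (hT κ u) hCT ((min_le_right _ _).trans (min_le_right _ _))
  have hP := vertexFamily_vertexOfK (N := Lc) hX1 hCX (locStencil_unitS (sf := sf) (sm := sm) (locStencil_slotPsiS (d := d) hLc0 r hS1 hm0.le)) hm0 le_rfl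
  have hV := vertexFamily_vertexOfK (N := Lc) hX1 hCX (locStencil_unitS (sf := sf) (sm := sm) (locStencil_slotPsiS (d := d) hLc0 r hT1 hm0.le)) hm0 le_rfl
  exact ⟨m / 2, _, _, _, half_pos hm0, hCX, decays_mono hX1 hCX le_rfl (by linarith), hP, hV⟩

/-- NOT IN PRINT; OUR BOOKKEEPING ([folklore]; (24) AT THE COMB DATA, GENERIC HALF).  **THE DIRECT WORD OVER TRANSPORTED TABLES VANISHES WHEN THE MULTIPLIER ROWS OF `X̃♮_j` KILL THE CURRENT OF
THE UNTRANSPORTED `T`-VERTEX** (in-block kernel root `toSite rb`, transport root `r ∈ box`, `1 ≤ Lc`, every `j`, all units, any axes, any cell bond `c`; `S′` local with zero ff block; `T`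
local without `(inr ·, inl β)` rows; `t` bounded, `Lc`-periodic in its site, `Σ'_{(u′,w)} 𝟙f(w_β)·vertexOfK X̃♮_j Lc (unitS T) ν u′ z w (inl b)(inl β) = t b z`, killed by the multiplier rows of
`X̃♮_j`): `Σ'_{u′} Σ'_{(y,w)} 𝟙f(y_α)𝟙f(w_β)·((vertexOfK X̃♮_j Lc (unitS (𝒯S′)) μ c ∘ X̃♮_j) ∘ vertexOfK X̃♮_j Lc (unitS (𝒯T)) ν u′) y w (inl α)(inl β) = 0`, `𝒯S κ u := Ψ̂ᵀ∘slotPsiS r Lc S κ u∘Ψ̂`.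
ROUTE: F8 §1 on both vertices ⨾ Tools §1 (outer legs drop, per bond) ⨾ leaf-04 g68 `NoFFWordCurrentKill.tsum_noFF_left_right_word_eq_zero_of_current` with `P := vertexOfK X̃♮_j Lc (unitS (slotPsiS S′)) μ c`
(no ff block, Tools §2), `Y := Ψ̂X̃♮_jΨ̂ᵀ`, `R := vertexOfK X̃♮_j Lc (unitS (slotPsiS T)) ν` (no multiplier first legs, Tools §2), its current `= t` by §1, `hkill` by Tools §4. -/
theorem tsum_transported_direct_word_eq_zero_of_current (hLc : 1 ≤ Lc) (hrb : rb ∈ box (d + 1) Lc) (hr : r ∈ box (d + 1) Lc) (sf sm : ℝ) (j : ℕ)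
    (hS : LocStencil S' Cs δs) (hδs : 0 < δs) (hSff : ∀ (κ' : Fin (d + 1)) (t x z : Site (d + 1)) (α' a : Fin (d + 1)), S' κ' t x z (Sum.inl α') (Sum.inl a) = 0)
    (hT : LocStencil T CT δT) (hδT : 0 < δT) (hTmf : ∀ (κ' : Fin (d + 1)) (t x z : Site (d + 1)) (m : Fin (d + 1)), T κ' t x z (Sum.inr m) (Sum.inl β) = 0) (c : Site (d + 1))
    {t : Fin (d + 1) → Site (d + 1) → ℝ} {M : ℝ}
    (ht : ∀ (b : Fin (d + 1)) (z : Site (d + 1)), ∑' uw : Site (d + 1) × Site (d + 1), (if uw.2 β % (Lc : ℤ) = (Lc : ℤ) - 1 then (1 : ℝ) else 0) *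
      vertexOfK (unitK sf sm (coDressKBmAt (toSite rb) Lc (KInvStep (d := d) Lc j))) Lc (unitS sf sm T) ν uw.1 z uw.2 (Sum.inl b) (Sum.inl β) = t b z)
    (htb : ∀ b z, |t b z| ≤ M) (htper : ∀ (b : Fin (d + 1)) (z s : Site (d + 1)), t b (z + (Lc : ℤ) • s) = t b z)
    (hkill : ∀ (y₁ : Site (d + 1)) (m : Fin (d + 1)), ∑' z : Site (d + 1), ∑ b : Fin (d + 1),
      unitK sf sm (coDressKBmAt (toSite rb) Lc (KInvStep (d := d) Lc j)) y₁ z (Sum.inr m) (Sum.inl b) * t b z = 0) :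
    ∑' u' : Site (d + 1), ∑' yw : Site (d + 1) × Site (d + 1), (if yw.1 α % (Lc : ℤ) = (Lc : ℤ) - 1 then (1 : ℝ) else 0) * (if yw.2 β % (Lc : ℤ) = (Lc : ℤ) - 1 then (1 : ℝ) else 0) *
        comp (comp (vertexOfK (unitK sf sm (coDressKBmAt (toSite rb) Lc (KInvStep (d := d) Lc j))) Lc
            (unitS sf sm (fun κ u => comp (comp (trK (psiKS r Lc)) (slotPsiS r Lc S' κ u)) (psiKS r Lc))) μ c)
          (unitK sf sm (coDressKBmAt (toSite rb) Lc (KInvStep (d := d) Lc j))))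
          (vertexOfK (unitK sf sm (coDressKBmAt (toSite rb) Lc (KInvStep (d := d) Lc j))) Lc
            (unitS sf sm (fun κ u => comp (comp (trK (psiKS r Lc)) (slotPsiS r Lc T κ u)) (psiKS r Lc))) ν u')
          yw.1 yw.2 (Sum.inl α) (Sum.inl β) = 0 := by
  classical
  have hLc0 : 0 < Lc := hLc
  set X := unitK sf sm (coDressKBmAt (toSite rb) Lc (KInvStep (d := d) Lc j)) with hX
  set P' := vertexOfK X Lc (unitS sf sm (slotPsiS r Lc S')) μ c with hP'
  set V' := vertexOfK X Lc (unitS sf sm (slotPsiS r Lc T)) ν with hV'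
  obtain ⟨δ, CX, CP, CV, hδ, hCX, hXd, hPf, hVf⟩ := exists_vertex_data (r := r) hLc hrb sf sm j hS hδs hT hδT
  have hXspr : Spr X := ⟨_, _, hδ, hXd⟩
  have h₁ : ∀ y : Site (d + 1), |(if y α % (Lc : ℤ) = (Lc : ℤ) - 1 then (1 : ℝ) else 0)| ≤ 1 := fun y => by split_ifs <;> simp
  have h₂ : ∀ w : Site (d + 1), |(if w β % (Lc : ℤ) = (Lc : ℤ) - 1 then (1 : ℝ) else 0)| ≤ 1 := fun w => by split_ifs <;> simp
  -- steps 1–2: transports out of both vertices, outer legs drop, per bond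
  have e : ∀ u' : Site (d + 1), (∑' yw : Site (d + 1) × Site (d + 1), (if yw.1 α % (Lc : ℤ) = (Lc : ℤ) - 1 then (1 : ℝ) else 0) * (if yw.2 β % (Lc : ℤ) = (Lc : ℤ) - 1 then (1 : ℝ) else 0) *
        comp (comp (vertexOfK X Lc (unitS sf sm (fun κ u => comp (comp (trK (psiKS r Lc)) (slotPsiS r Lc S' κ u)) (psiKS r Lc))) μ c) X)
          (vertexOfK X Lc (unitS sf sm (fun κ u => comp (comp (trK (psiKS r Lc)) (slotPsiS r Lc T κ u)) (psiKS r Lc))) ν u') yw.1 yw.2 (Sum.inl α) (Sum.inl β))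
      = ∑' yw : Site (d + 1) × Site (d + 1), (if yw.1 α % (Lc : ℤ) = (Lc : ℤ) - 1 then (1 : ℝ) else 0) * (if yw.2 β % (Lc : ℤ) = (Lc : ℤ) - 1 then (1 : ℝ) else 0) *
        comp (comp P' (comp (comp (psiKS r Lc) X) (trK (psiKS r Lc)))) (V' u') yw.1 yw.2 (Sum.inl α) (Sum.inl β) := by
    intro u'
    rw [vertexOfK_unitS_transport_eq_conj hLc0 hr hXspr sf sm hS hδs μ c, vertexOfK_unitS_transport_eq_conj hLc0 hr hXspr sf sm hT hδT ν u']
    exact tsum_twoFace_conj_word_eq hLc0 hr (hPf μ c) hδ (hVf ν u') hδ hXd hδ h₁ (fun y s => face_weight_periodic Lc α y s) h₂ (fun w s => face_weight_periodic Lc β w s) _ _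
  rw [tsum_congr e]
  -- step 3: the generic word lemma
  obtain ⟨CY, hCY, hY⟩ := exists_decays_sandwich hLc0 hr hXd hδ
  refine tsum_noFF_left_right_word_eq_zero_of_current (N := Lc) (hPf μ c) hδ (fun y z α' a => ?_) hY (by positivity) (fun u' => hVf ν u') hδ
    (fun u' z w m => ?_) h₁ h₂ (fun b z => ?_) htb (fun y₁ m => ?_) α
  · exact vertexOfK_unitS_slotPsiS_entry_eq_zero r X Lc sf sm (fun κ t' x z' => hSff κ t' x z' α' a) μ c y z
  · exact vertexOfK_unitS_slotPsiS_entry_eq_zero r X Lc sf sm (fun κ t' x z' => hTmf κ t' x z' m) ν u' z w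
  · rw [tsum_prod_weight_vertexOfK_dressedStep_slotPsiS hLc hrb sf sm j ν r hT hδT h₂ z (Sum.inl b) (Sum.inl β)]
    exact ht b z
  · exact tsum_sum_sandwich_inr_inl_mul_eq_zero hLc0 hr hXd hδ htb htper hkill y₁ m

/-- NOT IN PRINT; OUR BOOKKEEPING ([folklore]; (24) AT THE COMB DATA, GENERIC HALF, THE SWAP).  **THE SWAP WORD OVER TRANSPORTED TABLES VANISHES** under the same data with `T`
leg-antisymmetric, without `(inr ·, inl α)` rows, and the current read at the leg `inl α` (`Σ'_{(u′,y)} 𝟙f(y_α)·vertexOfK X̃♮_j Lc (unitS T) ν u′ z y (inl b)(inl α) = t′ b z`, bounded,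
`Lc`-periodic, killed by the multiplier rows of `X̃♮_j`):
`Σ'_{u′} Σ'_{(y,w)} 𝟙f(y_α)𝟙f(w_β)·((vertexOfK X̃♮_j Lc (unitS (𝒯T)) ν u′ ∘ X̃♮_j) ∘ vertexOfK X̃♮_j Lc (unitS (𝒯S′)) μ c) y w (inl α)(inl β) = 0`.
ROUTE: F8 §1 ⨾ Tools §1 ⨾ leaf-04 g68 `NoFFWordCurrentKill.tsum_left_right_noFF_swap_word_eq_zero_of_current` with `Y := Ψ̂X̃♮_jΨ̂ᵀ` (`trK Y = sgnK Y`, Tools §3), `R := vertexOfK X̃♮_j Lc (unitS (slotPsiS T)) ν`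
(leg-antisymmetric, Tools §2), its `α`-read current `= t′` by §1, `hkill′` by Tools §4. -/
theorem tsum_transported_swap_word_eq_zero_of_current (hLc : 1 ≤ Lc) (hrb : rb ∈ box (d + 1) Lc) (hr : r ∈ box (d + 1) Lc) (sf sm : ℝ) (j : ℕ)
    (hS : LocStencil S' Cs δs) (hδs : 0 < δs) (hSff : ∀ (κ' : Fin (d + 1)) (t x z : Site (d + 1)) (α' a : Fin (d + 1)), S' κ' t x z (Sum.inl α') (Sum.inl a) = 0)
    (hT : LocStencil T CT δT) (hδT : 0 < δT) (hTa : ∀ (κ' : Fin (d + 1)) (u x z : Site (d + 1)) (a b : Fib d), T κ' u z x b a = -T κ' u x z a b)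
    (hTmf : ∀ (κ' : Fin (d + 1)) (t x z : Site (d + 1)) (m : Fin (d + 1)), T κ' t x z (Sum.inr m) (Sum.inl α) = 0) (c : Site (d + 1))
    {t' : Fin (d + 1) → Site (d + 1) → ℝ} {M : ℝ}
    (ht' : ∀ (b : Fin (d + 1)) (z : Site (d + 1)), ∑' uy : Site (d + 1) × Site (d + 1), (if uy.2 α % (Lc : ℤ) = (Lc : ℤ) - 1 then (1 : ℝ) else 0) *
      vertexOfK (unitK sf sm (coDressKBmAt (toSite rb) Lc (KInvStep (d := d) Lc j))) Lc (unitS sf sm T) ν uy.1 z uy.2 (Sum.inl b) (Sum.inl α) = t' b z)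
    (htb' : ∀ b z, |t' b z| ≤ M) (htper' : ∀ (b : Fin (d + 1)) (z s : Site (d + 1)), t' b (z + (Lc : ℤ) • s) = t' b z)
    (hkill' : ∀ (y₁ : Site (d + 1)) (m : Fin (d + 1)), ∑' z : Site (d + 1), ∑ b : Fin (d + 1),
      unitK sf sm (coDressKBmAt (toSite rb) Lc (KInvStep (d := d) Lc j)) y₁ z (Sum.inr m) (Sum.inl b) * t' b z = 0) :
    ∑' u' : Site (d + 1), ∑' yw : Site (d + 1) × Site (d + 1), (if yw.1 α % (Lc : ℤ) = (Lc : ℤ) - 1 then (1 : ℝ) else 0) * (if yw.2 β % (Lc : ℤ) = (Lc : ℤ) - 1 then (1 : ℝ) else 0) *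
        comp (comp (vertexOfK (unitK sf sm (coDressKBmAt (toSite rb) Lc (KInvStep (d := d) Lc j))) Lc
            (unitS sf sm (fun κ u => comp (comp (trK (psiKS r Lc)) (slotPsiS r Lc T κ u)) (psiKS r Lc))) ν u')
          (unitK sf sm (coDressKBmAt (toSite rb) Lc (KInvStep (d := d) Lc j))))
          (vertexOfK (unitK sf sm (coDressKBmAt (toSite rb) Lc (KInvStep (d := d) Lc j))) Lc
            (unitS sf sm (fun κ u => comp (comp (trK (psiKS r Lc)) (slotPsiS r Lc S' κ u)) (psiKS r Lc))) μ c)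
          yw.1 yw.2 (Sum.inl α) (Sum.inl β) = 0 := by
  classical
  have hLc0 : 0 < Lc := hLc
  set X := unitK sf sm (coDressKBmAt (toSite rb) Lc (KInvStep (d := d) Lc j)) with hX
  set P' := vertexOfK X Lc (unitS sf sm (slotPsiS r Lc S')) μ c with hP'
  set V' := vertexOfK X Lc (unitS sf sm (slotPsiS r Lc T)) ν with hV'
  obtain ⟨δ, CX, CP, CV, hδ, hCX, hXd, hPf, hVf⟩ := exists_vertex_data (r := r) hLc hrb sf sm j hS hδs hT hδT
  have hXspr : Spr X := ⟨_, _, hδ, hXd⟩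
  have h₁ : ∀ y : Site (d + 1), |(if y α % (Lc : ℤ) = (Lc : ℤ) - 1 then (1 : ℝ) else 0)| ≤ 1 := fun y => by split_ifs <;> simp
  have h₂ : ∀ w : Site (d + 1), |(if w β % (Lc : ℤ) = (Lc : ℤ) - 1 then (1 : ℝ) else 0)| ≤ 1 := fun w => by split_ifs <;> simp
  -- steps 1–2: transports out of both vertices, outer legs drop, per bond
  have e : ∀ u' : Site (d + 1), (∑' yw : Site (d + 1) × Site (d + 1), (if yw.1 α % (Lc : ℤ) = (Lc : ℤ) - 1 then (1 : ℝ) else 0) * (if yw.2 β % (Lc : ℤ) = (Lc : ℤ) - 1 then (1 : ℝ) else 0) *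
        comp (comp (vertexOfK X Lc (unitS sf sm (fun κ u => comp (comp (trK (psiKS r Lc)) (slotPsiS r Lc T κ u)) (psiKS r Lc))) ν u') X)
          (vertexOfK X Lc (unitS sf sm (fun κ u => comp (comp (trK (psiKS r Lc)) (slotPsiS r Lc S' κ u)) (psiKS r Lc))) μ c) yw.1 yw.2 (Sum.inl α) (Sum.inl β))
      = ∑' yw : Site (d + 1) × Site (d + 1), (if yw.1 α % (Lc : ℤ) = (Lc : ℤ) - 1 then (1 : ℝ) else 0) * (if yw.2 β % (Lc : ℤ) = (Lc : ℤ) - 1 then (1 : ℝ) else 0) *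
        comp (comp (V' u') (comp (comp (psiKS r Lc) X) (trK (psiKS r Lc)))) P' yw.1 yw.2 (Sum.inl α) (Sum.inl β) := by
    intro u'
    rw [vertexOfK_unitS_transport_eq_conj hLc0 hr hXspr sf sm hS hδs μ c, vertexOfK_unitS_transport_eq_conj hLc0 hr hXspr sf sm hT hδT ν u']
    exact tsum_twoFace_conj_word_eq hLc0 hr (hVf ν u') hδ (hPf μ c) hδ hXd hδ h₁ (fun y s => face_weight_periodic Lc α y s) h₂ (fun w s => face_weight_periodic Lc β w s) _ _
  rw [tsum_congr e]
  -- step 3: the generic swap lemma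
  obtain ⟨CY, hCY, hY⟩ := exists_decays_sandwich hLc0 hr hXd hδ
  have hYt : trK (comp (comp (psiKS r Lc) X) (trK (psiKS r Lc))) = sgnK (comp (comp (psiKS r Lc) X) (trK (psiKS r Lc))) :=
    trK_sandwich_dressedStep hLc0 hr hLc hrb sf sm j
  refine tsum_left_right_noFF_swap_word_eq_zero_of_current (N := Lc) (hPf μ c) hδ (fun y z α' a => ?_) hY (by positivity) hYt (fun u' => hVf ν u') hδ
    (fun u' => trK_vertexOfK_unitS_slotPsiS r Lc X Lc sf sm hTa ν u') (fun u' z w m => ?_) h₁ h₂ (fun b z => ?_) htb' (fun y₁ m => ?_) β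
  · exact vertexOfK_unitS_slotPsiS_entry_eq_zero r X Lc sf sm (fun κ t' x z' => hSff κ t' x z' α' a) μ c y z
  · exact vertexOfK_unitS_slotPsiS_entry_eq_zero r X Lc sf sm (fun κ t' x z' => hTmf κ t' x z' m) ν u' z w
  · rw [tsum_prod_weight_vertexOfK_dressedStep_slotPsiS hLc hrb sf sm j ν r hT hδT h₁ z (Sum.inl b) (Sum.inl α)]
    exact ht' b z
  · exact tsum_sum_sandwich_inr_inl_mul_eq_zero hLc0 hr hXd hδ htb' htper' hkill' y₁ m

end Reduction

end Summit.QuantumFields.BalabanUV.Beta.GAN24.TransportedWordReduction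

end
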